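import Literature.Probability.RandomPlanarGeometry.PlanarDomains
import HarnessLib

/-!
# Re-marking a Dobrushin domain at its second marked point

Stub `stub_reverseDobrushin` of the line `fk-anchor-transfer` for the crux `IsingBoundaryRatio`
(stmt-CriticalPhenomena-10650). The analytic heart of the line (arm-origin forgetting for critical
FK-Ising at a marked prime end) is proved at the FIRST marked point `D.pt 0` of a Dobrushin domain
`(D; a, b)`; to transport it to the second marked point `b = D.pt 1` one applies it to a Dobrushin
domain `D'` on the SAME Jordan domain (same carrier and same boundary loop) whose first marked
point is `b`.

Construction: keep `D.toJordanDomain` and take the marks `mark 1 < (mark 1 + 1) / 2`, both in the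
fundamental period `Ico 0 1` because `0 ≤ mark 1 < 1`. Then `D'.carrier = D.carrier` and
`D'.pt 0 = ∂D (mark 1) = D.pt 1` hold by `rfl` (cf. `MarkedDomain.chord`,
`MarkedDomain.pt_chord_zero` in `PlanarDomains`).

No new definitions; everything here is folklore bookkeeping on `MarkedDomain 2`.
-/

noncomputable section

open Set
open Literature.Probability.RandomPlanarGeometry

namespace Summit.CriticalPhenomena.SAWScalingLimit.Theorems.IsingBoundaryRatio

/-- **Stub `stub_reverseDobrushin`** (line `fk-anchor-transfer`, crux `IsingBoundaryRatio`): every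
Dobrushin domain `(D; a, b)` admits a Dobrushin domain `D'` with the same carrier whose first
marked point is `b = D.pt 1`. Witness: the same Jordan domain (same carrier AND same boundary
loop) with marks `mark 1 < (mark 1 + 1) / 2`, both in `Ico 0 1` since `0 ≤ mark 1 < 1`
(adapted from `MarkedDomain.chord`). [folklore] -/
theorem stub_reverseDobrushin :
    ∀ (D : DobrushinDomain), ∃ D' : DobrushinDomain, D'.carrier = D.carrier ∧ D'.pt 0 = D.pt 1 := by
  intro D
  have h0 : 0 ≤ D.mark 1 := (D.mark_mem 1).1
  have h1 : D.mark 1 < 1 := (D.mark_mem 1).2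
  exact
    ⟨{ toJordanDomain := D.toJordanDomain
       mark := ![D.mark 1, (D.mark 1 + 1) / 2]
       strictMono_mark := by
         refine Fin.strictMono_iff_lt_succ.2 fun k ↦ ?_
         fin_cases k
         simp only [Fin.zero_eta, Fin.castSucc_zero, Matrix.cons_val_zero, Fin.succ_zero_eq_one,
           Matrix.cons_val_one]
         linarith
       mark_mem := by
         intro k
         fin_cases k
         · simpa using D.mark_mem 1
         · simp only [Fin.mk_one, Matrix.cons_val_one, Matrix.cons_val_zero, mem_Ico]
           constructor <;> linarith },
      rfl, rfl⟩

end Summit.CriticalPhenomena.SAWScalingLimit.Theorems.IsingBoundaryRatio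

end
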